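import Summits.PneNP.PneNP.Theorems.Sd2BlMachineDictDecomp
import Summits.PneNP.PneNP.Theorems.SfmBlMachineDictSparse

/-!
# K1'' machine side (S3), DICTIONARY D2b (generic): sparseness of the computed remainder, and the four clauses bundled

Cell pnp-ideate, ROUND-18 item K1''; twin of `SfmBlMachineDictSparse` with `trips ↦ raw` and the threshold `γsq` as a
parameter.  Clause (sparse) for the COMPUTED decomposition `extract γsq plegs (cands plegs cap t₀ u₁) u₂`
(`plegs = pieceLegsG L raw`, `|u₁| = 2(t₀ − 1)` walk rounds under a non-binding cap, `|u₂| > |raw|` extraction rounds):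
every pair `(W₁, W₂)` of pieces connected for the leg relation of positions with `|W₁| + |W₂| ≤ t₀` carries at most
`√γsq · √(|W₁||W₂|)` remainder legs (`sparse_pG`: D1b connectivity dictionary ⟹ `exists_mem_cands` ⟹
`eCount_sq_le_of_mem_cands` ⟹ the count dictionary `eCountG_eq_card_filter`).  `decomposition_clausesG` bundles
hsp / hsides / hdense / hcov in the shapes of `Sd2Bl.legBound_of_pipeline` (threshold spelled `√γsq`; the instance
file rewrites `√(gRsq ℓ t) = 4ℓ·√(34ℓ·4ᵗ·2t)`).  Restricted-model algorithmic infrastructure; nothing here bears on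
`P` versus `NP`.
-/

set_option linter.dupNamespace false -- `Summit.PneNP.PneNP.…`: summit = sub-problem name (D-0017 single-conjunct layout)

namespace Summit.PneNP.PneNP.Theorems.Sd2BlMachine

open Literature.Computability.Complexity
open Summit.PneNP.PneNP.Theorems.SfmBlMachine (Lab PLeg labL labR Cand pieces walksU cands extract eCount inPair sidesOf
  mem_sidesOf_fst mem_sidesOf_snd nodup_sidesOf exists_mem_cands eCount_sq_le_of_mem_cands extractInv_extract spotInv_extract
  length_filter_eq_length_filter_range)
open Summit.PneNP.PneNP.Theorems.SfmBl (bipGraph)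

variable {L : ℕ} {raw : List RLeg}

/-! ## The machine's leg count of a candidate = the pipeline's count -/

/-- The sides of a candidate built from a label set: left side = the left pieces of `W₁`, right side = those of `W₂`. -/
theorem mem_sidesOf_labelsOfG (W₁ : Finset (LPieceG L raw)) (W₂ : Finset (RPieceG L raw))
    {vis : List Lab} (hvis : vis.toFinset = labelsOfG W₁ W₂) (i : LPieceG L raw) (k : RPieceG L raw) :
    (i.1 ∈ (sidesOf vis).1 ↔ i ∈ W₁) ∧ (k.1 ∈ (sidesOf vis).2 ↔ k ∈ W₂) := by
  constructor
  · rw [mem_sidesOf_fst, ← List.mem_toFinset, hvis, mem_labelsOfG_left]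
    exact ⟨fun h => h.1, fun h => ⟨h, LPieceG.tag L raw i⟩⟩
  · rw [mem_sidesOf_snd, ← List.mem_toFinset, hvis, mem_labelsOfG_right]
    exact ⟨fun h => h.1, fun h => ⟨h, RPieceG.tag L raw k⟩⟩

/-- The sides of such a candidate have `|W₁|` and `|W₂|` elements. -/
theorem length_sidesOf_labelsOfG (W₁ : Finset (LPieceG L raw)) (W₂ : Finset (RPieceG L raw))
    {vis : List Lab} (hvis : vis.toFinset = labelsOfG W₁ W₂) :
    (sidesOf vis).1.length = W₁.card ∧ (sidesOf vis).2.length = W₂.card := by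
  classical
  obtain ⟨hn1, hn2⟩ := nodup_sidesOf vis
  constructor
  · rw [← List.toFinset_card_of_nodup hn1, ← Finset.card_image_of_injective W₁ Subtype.val_injective]
    congr 1
    ext P
    rw [List.mem_toFinset, mem_sidesOf_fst, ← List.mem_toFinset, hvis, Finset.mem_image]
    constructor
    · rintro ⟨hP, h0⟩
      unfold labelsOfG at hP
      rcases Finset.mem_union.1 hP with h | h
      · obtain ⟨i, hi, rfl⟩ := Finset.mem_image.1 h; exact ⟨i, hi, rfl⟩
      · obtain ⟨k, _, rfl⟩ := Finset.mem_image.1 h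
        rw [RPieceG.tag L raw k] at h0; exact absurd h0 (by decide)
    · rintro ⟨i, hi, rfl⟩
      exact ⟨(mem_labelsOfG_left W₁ W₂ i).2 hi, LPieceG.tag L raw i⟩
  · rw [← List.toFinset_card_of_nodup hn2, ← Finset.card_image_of_injective W₂ Subtype.val_injective]
    congr 1
    ext P
    rw [List.mem_toFinset, mem_sidesOf_snd, ← List.mem_toFinset, hvis, Finset.mem_image]
    constructor
    · rintro ⟨hP, h1⟩
      unfold labelsOfG at hP
      rcases Finset.mem_union.1 hP with h | h
      · obtain ⟨i, _, rfl⟩ := Finset.mem_image.1 h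
        rw [LPieceG.tag L raw i] at h1; exact absurd h1 (by decide)
      · obtain ⟨k, hk, rfl⟩ := Finset.mem_image.1 h; exact ⟨k, hk, rfl⟩
    · rintro ⟨k, hk, rfl⟩
      exact ⟨(mem_labelsOfG_right W₁ W₂ k).2 hk, RPieceG.tag L raw k⟩

/-- **COUNT DICTIONARY**: the machine's `eCount` of a candidate with label set `labelsOfG W₁ W₂` is the pipeline's
number of remainder legs (positions) from `W₁` to `W₂`. -/
theorem eCountG_eq_card_filter (labels : List ℕ) (r : ℕ) (hlab : ∀ lab ∈ labels, lab ≤ r)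
    (hlen : labels.length = raw.length) (W₁ : Finset (LPieceG L raw)) (W₂ : Finset (RPieceG L raw))
    {vis : List Lab} (hvis : vis.toFinset = labelsOfG W₁ W₂) :
    eCount (pieceLegsG L raw) labels (sidesOf vis)
      = (Finset.univ.filter fun e : Fin raw.length =>
          pG labels r hlab e = none ∧ srcG L raw e ∈ W₁ ∧ dstG L raw e ∈ W₂).card := by
  classical
  unfold eCount
  have hzl : (labels.zip (pieceLegsG L raw)).length = raw.length := by
    rw [List.length_zip, hlen, length_pieceLegsG, min_self]
  rw [length_filter_eq_length_filter_range _ ((0 : ℕ), ((0, 0, 0, 0, 0, 0) : PLeg)), hzl]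
  have hP : (Finset.univ.filter fun e : Fin raw.length => pG labels r hlab e = none ∧ srcG L raw e ∈ W₁ ∧ dstG L raw e ∈ W₂)
      = Finset.univ.filter fun e : Fin raw.length =>
          inPair (sidesOf vis) ((labels.zip (pieceLegsG L raw)).getD e.val ((0 : ℕ), ((0, 0, 0, 0, 0, 0) : PLeg))) = true := by
    refine Finset.filter_congr fun e _ => ?_
    have hi : e.val < labels.length := by rw [hlen]; exact e.isLt
    have hp : e.val < (pieceLegsG L raw).length := by rw [length_pieceLegsG]; exact e.isLt
    have hz : (labels.zip (pieceLegsG L raw)).getD e.val ((0 : ℕ), ((0, 0, 0, 0, 0, 0) : PLeg))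
        = (labels[e.val], plegOfG L raw e) := by
      rw [List.getD_eq_getElem _ _ (by rw [List.length_zip]; exact lt_min hi hp), List.getElem_zip, pieceLegsG_getElem]
      rfl
    rw [hz, pG_eq_none_iff]
    unfold inPair labOfG
    rw [List.getD_eq_getElem _ _ hi]
    obtain ⟨h1, h2⟩ := mem_sidesOf_labelsOfG W₁ W₂ hvis (srcG L raw e) (dstG L raw e)
    simp only [Bool.and_eq_true, decide_eq_true_eq]
    exact ⟨fun ⟨ha, hb, hc⟩ => ⟨ha, h1.2 hb, h2.2 hc⟩, fun ⟨ha, hb, hc⟩ => ⟨ha, h1.1 hb, h2.1 hc⟩⟩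
  have h := card_filter_fin_eq (N := raw.length)
    (fun i => inPair (sidesOf vis) ((labels.zip (pieceLegsG L raw)).getD i ((0 : ℕ), ((0, 0, 0, 0, 0, 0) : PLeg))) = true)
  simp only [Bool.decide_eq_true] at h
  rw [hP]
  exact h.symm

/-! ## Clause (sparse) -/

/-- **Clause (sparse) for the COMPUTED decomposition**, threshold `√γsq`. -/
theorem sparse_pG (γsq L : ℕ) (raw : List RLeg) (cap t₀ : ℕ) (u₁ : List Unit) (hu₁ : u₁.length = 2 * (t₀ - 1))
    (hcap : ∀ k, k ≤ u₁.length → (walksU (pieceLegsG L raw) k).length ≤ cap)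
    (u₂ : List Unit) (hu₂ : (pieceLegsG L raw).length < u₂.length)
    (hlab : ∀ lab ∈ (extract γsq (pieceLegsG L raw) (cands (pieceLegsG L raw) cap t₀ u₁) u₂).1,
      lab ≤ (extract γsq (pieceLegsG L raw) (cands (pieceLegsG L raw) cap t₀ u₁) u₂).2)
    (W₁ : Finset (LPieceG L raw)) (W₂ : Finset (RPieceG L raw))
    (hconn : ((bipGraph (fun i k => ∃ e, srcG L raw e = i ∧ dstG L raw e = k)).induce
        {x | Sum.elim (fun i => i ∈ W₁) (fun k => k ∈ W₂) x}).Connected)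
    (hsize : W₁.card + W₂.card ≤ t₀) :
    ((Finset.univ.filter fun e : Fin raw.length =>
        pG _ _ hlab e = none ∧ srcG L raw e ∈ W₁ ∧ dstG L raw e ∈ W₂).card : ℝ)
      ≤ Real.sqrt γsq * Real.sqrt ((W₁.card : ℝ) * (W₂.card : ℝ)) := by
  classical
  by_cases h₁ : W₁ = ∅
  · refine sparse_of_count_zero (Finset.card_eq_zero.2 (Finset.filter_eq_empty_iff.2 ?_))
    intro e _ h; rw [h₁] at h; exact absurd h.2.1 (Finset.notMem_empty _)
  by_cases h₂ : W₂ = ∅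
  · refine sparse_of_count_zero (Finset.card_eq_zero.2 (Finset.filter_eq_empty_iff.2 ?_))
    intro e _ h; rw [h₂] at h; exact absurd h.2.2 (Finset.notMem_empty _)
  have hW₁ : 0 < W₁.card := Finset.card_pos.2 (Finset.nonempty_iff_ne_empty.2 h₁)
  have hW₂ : 0 < W₂.card := Finset.card_pos.2 (Finset.nonempty_iff_ne_empty.2 h₂)
  have hcardS := card_labelsOfG W₁ W₂
  have hconn' := (connected_pipelineG_iff_connected_labels W₁ W₂).1 hconn
  obtain ⟨W, hW, vis, hWvis, hvis⟩ := exists_mem_cands (pieceLegsG L raw) cap t₀ u₁ hu₁ hcap (labelsOfG W₁ W₂)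
    (labelsOfG_subset_pieces W₁ W₂) (by omega) (by omega) hconn'
  subst hWvis
  have hle := eCount_sq_le_of_mem_cands γsq (pieceLegsG L raw) (cands (pieceLegsG L raw) cap t₀ u₁) u₂ hu₂ hW
  have hlen : (extract γsq (pieceLegsG L raw) (cands (pieceLegsG L raw) cap t₀ u₁) u₂).1.length = raw.length := by
    have := (extractInv_extract γsq (pieceLegsG L raw) (cands (pieceLegsG L raw) cap t₀ u₁) u₂).1
    rw [length_pieceLegsG] at this; exact this
  obtain ⟨hl1, hl2⟩ := length_sidesOf_labelsOfG W₁ W₂ hvis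
  rw [hl1, hl2] at hle
  rw [← eCountG_eq_card_filter _ _ hlab hlen W₁ W₂ hvis]
  exact sparse_of_not_dense_le (not_lt.2 hle) le_rfl

/-! ## The four decomposition clauses, bundled -/

/-- **THE COMPUTED DECOMPOSITION SATISFIES THE PIPELINE'S CLAUSES** (hsp, hsides, hdense, hcov of
`Sd2Bl.legBound_of_pipeline` with threshold `√γsq`, legs = positions, `src := srcG L raw`, `dst := dstG L raw`,
`r := st.2`, `p := pG st.1 st.2 _`, `V₁ := V₁G …`, `V₂ := V₂G …`, for the machine's extraction `st` with density
constant `γsq`, candidates from `2(t₀−1)` walk rounds under a non-binding cap, and more than `|raw|` extraction rounds). -/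
theorem decomposition_clausesG (γsq L : ℕ) (raw : List RLeg) (cap t₀ : ℕ) (u₁ : List Unit)
    (hu₁ : u₁.length = 2 * (t₀ - 1))
    (hcap : ∀ k, k ≤ u₁.length → (walksU (pieceLegsG L raw) k).length ≤ cap)
    (u₂ : List Unit) (hu₂ : (pieceLegsG L raw).length < u₂.length) :
    let plegs := pieceLegsG L raw
    let st := extract γsq plegs (cands plegs cap t₀ u₁) u₂
    ∃ hlab : ∀ lab ∈ st.1, lab ≤ st.2,
      (∀ (W₁ : Finset (LPieceG L raw)) (W₂ : Finset (RPieceG L raw)),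
        ((bipGraph (fun i k => ∃ e, srcG L raw e = i ∧ dstG L raw e = k)).induce
            {x | Sum.elim (fun i => i ∈ W₁) (fun k => k ∈ W₂) x}).Connected →
        W₁.card + W₂.card ≤ t₀ →
        ((Finset.univ.filter fun e : Fin raw.length =>
            pG st.1 st.2 hlab e = none ∧ srcG L raw e ∈ W₁ ∧ dstG L raw e ∈ W₂).card : ℝ)
          ≤ Real.sqrt γsq * Real.sqrt ((W₁.card : ℝ) * (W₂.card : ℝ))) ∧
      (∀ (s : Fin st.2) (e : Fin raw.length), pG st.1 st.2 hlab e = some s →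
        srcG L raw e ∈ V₁G L raw st.1 st.2 hlab s ∧ dstG L raw e ∈ V₂G L raw st.1 st.2 hlab s) ∧
      (∀ s : Fin st.2, Real.sqrt γsq *
          Real.sqrt (((V₁G L raw st.1 st.2 hlab s).card : ℝ) * ((V₂G L raw st.1 st.2 hlab s).card : ℝ))
        < ((Finset.univ.filter fun e : Fin raw.length => pG st.1 st.2 hlab e = some s).card : ℝ)) ∧
      (∀ s : Fin st.2, (V₁G L raw st.1 st.2 hlab s).card + (V₂G L raw st.1 st.2 hlab s).card
        ≤ 2 * (Finset.univ.filter fun e : Fin raw.length => pG st.1 st.2 hlab e = some s).card) := by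
  intro plegs st
  have hI := extractInv_extract γsq plegs (cands plegs cap t₀ u₁) u₂
  have hlen : st.1.length = raw.length := by
    have := hI.1; rw [length_pieceLegsG] at this; exact this
  refine ⟨hI.2.1, fun W₁ W₂ hconn hsize => sparse_pG γsq L raw cap t₀ u₁ hu₁ hcap u₂ hu₂ hI.2.1 W₁ W₂ hconn hsize,
    fun s e he => ⟨srcG_mem_V₁G L raw st.1 st.2 hI.2.1 he, dstG_mem_V₂G L raw st.1 st.2 hI.2.1 he⟩,
    fun s => dense_V₁G_V₂G γsq L raw (cands plegs cap t₀ u₁) st hI.2.1 hlen (spotInv_extract γsq plegs (cands plegs cap t₀ u₁) u₂) s,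
    fun s => card_V₁G_add_card_V₂G_le L raw st.1 st.2 hI.2.1 s⟩

end Summit.PneNP.PneNP.Theorems.Sd2BlMachine
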